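import Literature.Computability.Cryptography.MaskedOracleLemma
import Literature.Computability.Complexity.CoinTruncation
import Literature.Computability.Complexity.FoldBricks
import HarnessLib

/-!
# A classically secure PRP composed with a hidden XOR-mask representative stays pseudorandom

Topic `Literature/Computability/Cryptography`. The CLASSICAL leg of the Servedio–Gortler / Simon
variant of the `P/poly`-oracle separation of Aaronson–Chen 2017, Thm. 7.6 (the construction
"independently proposed by Zhandry and by Servedio and Gortler", [AaronsonChen2017] §1, pp. 9 and
11): for a classically secure pseudorandom permutation `PRP^raw = F` with block length `ℓ n ≥ n`,
NO probabilistic polynomial-time oracle adversary distinguishes `PRP^raw_k` (`k` uniform) from the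
MASKED family `PRP^raw_k ∘ rep_s` (`k` uniform, `s` a uniform mask with head bit `1`;
`rep_s x` = the element of `{x, x ⊕ s}` with head bit `0`, `MaskedOracleLemma.lean`) with
non-negligible advantage (`maskedPRP_indist`, `maskedPRP_eventually_le`) — the analogue, for XOR
masks, of Lemma 7.5 (1) of [AaronsonChen2017] ("no classical algorithm can distinguish them"), and the
computational counterpart of Servedio–Gortler 2004, Thm. 6.1 (ii) / Simon 1997, Thm. 3.4 (classical
hardness of finding the mask).

**The hybrid argument** (five games, all for one PPT adversary `𝒜` with round budget `fuel`):
`PRP_k` —(PRP security)— random permutation `σ` —(switching, `PRPSwitchingLemma.lean`)— random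
function `h` —(XOR-mask lemma, `MaskedOracleLemma.lean`: `fuel²/2^{ℓ n − 1}`)— `h ∘ rep_s`
—(switching under the mask: `fuel²/2^{ℓ n}`)— `σ ∘ rep_s` —(PRP security of the MASK ADVERSARY
`𝒜.maskAdv B`)— `PRP_k ∘ rep_s`. The mask adversary draws `B(n)` extra coins `m` in front of the coins
of `𝒜`, runs `𝒜` (the tree's input pre-processing `OracleAlg.comap` with the coin splitter
`dropSndFn B`), and translates every query `q` to `rep_{1·m} q` (the tree's query rewriting
`OracleAlg.mapQuery`, `OracleQueryMap.lean`, with the string brick `transFn`: "if the head bit of `q`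
is `1`, XOR `q` with `1·m`" — `zipXorFn`, a fold of one-bit XORs); it is PPT by
`isPolyTime_comap`/`isPolyTime_mapQuery`, and against an oracle answering only at length `ℓ n ≤ B n`
its acceptance probability is the average over the masks of that of `𝒜` against the masked oracle
(`acceptProb_maskAdv`).

## Main statements

* `maskSet a` (masks with head bit `1`, `card_maskSet`), `maskRealProb`, `idealMaskFnProb`,
  `idealMaskPermProb` and their coin-averaged forms.
* `abs_prfIdealProb_sub_idealMaskFnProb_le`, `abs_idealMaskFnProb_sub_idealMaskPermProb_le`
  (information-theoretic legs).
* `transQ`, `transFn`, `transFn_apply`, `transFn_mem_FP`; `OracleAdversary.maskAdv`, `isPPT_maskAdv`,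
  `acceptProb_maskAdv`, `prfRealProb_maskAdv`, `prpIdealProb_maskAdv` (the computational leg).
* `maskedPRP_indist`, `maskedPRP_eventually_le`.

## References

* [ServedioGortler2004] R. Servedio, S. Gortler, SIAM J. Comput. 33 (2004), §6, Thm. 6.1.
* [AaronsonChen2017] S. Aaronson, L. Chen, CCC 2017 (arXiv:1612.05903), §1 (pp. 9, 11), Lemma 7.5 (1)
  (p. 30) and App. 13 (p. 42: the hybrid through the truly random function).
* [Goldreich2001] O. Goldreich, *Foundations of Cryptography I*, Prop. 3.7.3 (switching), §3.6.
* [AroraBarak2009] S. Arora, B. Barak, *Computational Complexity*, §3.4, Def. 7.3, §1.3.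
-/

noncomputable section

namespace Literature.Computability.Cryptography

open Filter Asymptotics _root_.Computability Complexity Complexity.Brick Finset

/-! ### Masks with head bit `1` -/

/-- **The masks** of `{0,1}^a`: the vectors with head bit `1` (so that `rep_s` is the
head-bit representative and a uniform mask costs `a − 1` coins after a leading `1`).
[cite: ServedioGortler2004, §6 ("`0ⁿ ≠ s`")] -/
def maskSet (a : ℕ) : Finset (List.Vector Bool a) :=
  open scoped Classical in Finset.univ.filter fun s => s.toList.head? = some true

/-- Membership in the mask set. [folklore] -/
theorem mem_maskSet {a : ℕ} {s : List.Vector Bool a} : s ∈ maskSet a ↔ s.toList.head? = some true := by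
  classical
  simp [maskSet]

/-- The masks of `{0,1}^{m+1}` are the vectors `1·t`, `t ∈ {0,1}^m`. [folklore] -/
theorem maskSet_succ_eq_image (m : ℕ) :
    maskSet (m + 1) = Finset.univ.image fun t : List.Vector Bool m => List.Vector.cons true t := by
  classical
  ext s
  rw [mem_maskSet, Finset.mem_image]
  constructor
  · intro hs
    refine ⟨s.tail, Finset.mem_univ _, ?_⟩
    obtain ⟨l, hl⟩ := s
    rcases l with _ | ⟨b, l⟩
    · simp at hl
    · simp only [List.Vector.toList_mk, List.head?_cons, Option.some.injEq] at hs
      subst hs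
      rfl
  · rintro ⟨t, -, rfl⟩
    rfl

/-- **There are `2^m` masks of `{0,1}^{m+1}`.** [folklore] -/
theorem card_maskSet_succ (m : ℕ) : (maskSet (m + 1)).card = 2 ^ m := by
  classical
  rw [maskSet_succ_eq_image, Finset.card_image_of_injective _ (fun t t' h => by
    simpa using congrArg List.Vector.tail h), Finset.card_univ, card_vector, Fintype.card_bool]

/-- The number of masks of `{0,1}^a` is `2^{a−1}` for `a ≥ 1`. [folklore] -/
theorem card_maskSet {a : ℕ} (ha : 1 ≤ a) : (maskSet a).card = 2 ^ (a - 1) := by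
  obtain ⟨m, rfl⟩ : ∃ m, a = m + 1 := ⟨a - 1, by omega⟩
  rw [card_maskSet_succ, Nat.add_sub_cancel]

/-- The mask set is nonempty for `a ≥ 1`. [folklore] -/
theorem maskSet_nonempty {a : ℕ} (ha : 1 ≤ a) : (maskSet a).Nonempty := by
  rw [← Finset.card_pos, card_maskSet ha]
  exact Nat.two_pow_pos _

/-! ### The three mask games -/

/-- **The real mask game**: `Pr_{k ← U_{κ n}, s ← masks}[𝒜^{PRP_k ∘ rep_s}(1ⁿ) = 1]`, the acceptance
probability of `𝒜` against `F n k ∘ repStr s` on queries of length `ℓ n`, averaged over a uniform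
key and a uniform mask with head bit `1`. [cite: ServedioGortler2004, §8.1 (the masked pseudorandom functions)] [cite: AaronsonChen2017, §1 (p. 11)] -/
def maskRealProb (F : FunctionEnsemble) (κ ℓ : ℕ → ℕ) (𝒜 : OracleAdversary Bool) (n : ℕ) : ℝ :=
  (∑ k : List.Vector Bool (κ n), ∑ s ∈ maskSet (ℓ n),
      𝒜.acceptProb (oracleOfFnAt (ℓ n) (F n k.toList ∘ repStr s.toList)) n) /
    (2 ^ κ n * ((maskSet (ℓ n)).card : ℝ))

/-- **The ideal mask game with a random function**: the acceptance probability of `𝒜` against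
`h ∘ rep_s` for a uniformly random function table `h` on `{0,1}^{ℓ n}`, averaged over the masks.
[cite: ServedioGortler2004, Thm. 6.1] -/
def idealMaskFnProb (ℓ : ℕ → ℕ) (𝒜 : OracleAdversary Bool) (n : ℕ) : ℝ :=
  (∑ s ∈ maskSet (ℓ n),
      (((randomFunctionPMF (ℓ n) (ℓ n)).bind fun H =>
          𝒜.outputPMF (oracleOfTable (H ∘ repV s)) (unaryEncodeNat n)) (some true)).toReal) /
    ((maskSet (ℓ n)).card : ℝ)

/-- **The ideal mask game with a random permutation**: the same with a uniformly random permutation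
`σ` of `{0,1}^{ℓ n}`. [cite: ServedioGortler2004, Thm. 6.1] -/
def idealMaskPermProb (ℓ : ℕ → ℕ) (𝒜 : OracleAdversary Bool) (n : ℕ) : ℝ :=
  (∑ s ∈ maskSet (ℓ n),
      (((randomPermPMF (ℓ n)).bind fun σ =>
          𝒜.outputPMF (oracleOfTable (σ ∘ repV s)) (unaryEncodeNat n)) (some true)).toReal) /
    ((maskSet (ℓ n)).card : ℝ)

/-- `|1ⁿ| = n`. [folklore] -/
private theorem length_unaryEncodeNat_mask (n : ℕ) : (unaryEncodeNat n).length = n :=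
  unary_decode_encode_nat n

/-- The random-function mask game at one mask, as an average over the coins of `prF ⊥`.
[cite: Goldreich2001, Def. 3.6.4] -/
theorem idealMaskFn_term_eq_avg (ℓ : ℕ → ℕ) (𝒜 : OracleAdversary Bool) (n : ℕ)
    (s : List.Vector Bool (ℓ n)) :
    (((randomFunctionPMF (ℓ n) (ℓ n)).bind fun H =>
        𝒜.outputPMF (oracleOfTable (H ∘ repV s)) (unaryEncodeNat n)) (some true)).toReal =
      (∑ r : List.Vector Bool (𝒜.coins.eval (unaryEncodeNat n).length),
          prF (fun _ => none) fun h : List.Vector Bool (ℓ n) → List.Vector Bool (ℓ n) =>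
            𝒜.alg.runAux (oracleOfTable (h ∘ repV s)) (boolPair (unaryEncodeNat n) r.toList)
              (𝒜.fuel.eval (unaryEncodeNat n).length) [] = some true) /
        2 ^ 𝒜.coins.eval (unaryEncodeNat n).length := by
  classical
  rw [PMF.bind_apply, tsum_fintype, ENNReal.toReal_sum (fun a _ =>
    ENNReal.mul_ne_top (PMF.apply_ne_top _ _) (PMF.apply_ne_top _ _))]
  simp only [ENNReal.toReal_mul, randomFunctionPMF_apply, outputPMF_toReal_eq_card,
    ENNReal.toReal_inv, ENNReal.toReal_natCast, prF_bot_eq, Finset.card_filter, OracleAlg.run]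
  push_cast
  simp only [Finset.sum_div, Finset.mul_sum]
  rw [Finset.sum_comm]
  refine Finset.sum_congr rfl fun r _ => Finset.sum_congr rfl fun h _ => ?_
  ring

/-- The random-permutation mask game at one mask, as an average over the coins of `prP ⊥`.
[cite: Goldreich2001, Def. 3.7.2] -/
theorem idealMaskPerm_term_eq_avg (ℓ : ℕ → ℕ) (𝒜 : OracleAdversary Bool) (n : ℕ)
    (s : List.Vector Bool (ℓ n)) :
    (((randomPermPMF (ℓ n)).bind fun σ =>
        𝒜.outputPMF (oracleOfTable (σ ∘ repV s)) (unaryEncodeNat n)) (some true)).toReal =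
      (∑ r : List.Vector Bool (𝒜.coins.eval (unaryEncodeNat n).length),
          prP (fun _ => none) fun h : List.Vector Bool (ℓ n) → List.Vector Bool (ℓ n) =>
            𝒜.alg.runAux (oracleOfTable (h ∘ repV s)) (boolPair (unaryEncodeNat n) r.toList)
              (𝒜.fuel.eval (unaryEncodeNat n).length) [] = some true) /
        2 ^ 𝒜.coins.eval (unaryEncodeNat n).length := by
  classical
  rw [PMF.bind_apply, tsum_fintype, ENNReal.toReal_sum (fun a _ =>
    ENNReal.mul_ne_top (PMF.apply_ne_top _ _) (PMF.apply_ne_top _ _))]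
  simp only [ENNReal.toReal_mul, randomPermPMF_apply, outputPMF_toReal_eq_card,
    ENNReal.toReal_inv, ENNReal.toReal_natCast, prP_bot_eq, Finset.card_filter, OracleAlg.run]
  push_cast
  simp only [Finset.sum_div, Finset.mul_sum]
  rw [Finset.sum_comm]
  refine Finset.sum_congr rfl fun r _ => Finset.sum_congr rfl fun σ _ => ?_
  ring

/-- An average of terms each within `ε` of a fixed number is within `ε` of it. [folklore] -/
theorem abs_sub_avg_le {ι : Type*} {S : Finset ι} (hS : S.Nonempty) {c ε : ℝ} {g : ι → ℝ}
    (h : ∑ i ∈ S, |c - g i| ≤ ε * S.card) : |c - (∑ i ∈ S, g i) / S.card| ≤ ε := by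
  have hcard : (0 : ℝ) < S.card := by exact_mod_cast hS.card_pos
  have key : c - (∑ i ∈ S, g i) / S.card = (∑ i ∈ S, (c - g i)) / S.card := by
    rw [Finset.sum_sub_distrib, Finset.sum_const, nsmul_eq_mul]
    field_simp
  rw [key, abs_div, abs_of_pos hcard, div_le_iff₀ hcard]
  exact (Finset.abs_sum_le_sum_abs _ _).trans h

/-- **Leg 3 (the XOR-mask lemma): random function versus masked random function.** For every
oracle adversary with round budget `fuel` (no complexity bound needed),
`|prfIdealProb − idealMaskFnProb| ≤ fuel(n)²/|masks|`. [cite: ServedioGortler2004, Thm. 6.1 (ii)] -/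
theorem abs_prfIdealProb_sub_idealMaskFnProb_le (ℓ : ℕ → ℕ) (𝒜 : OracleAdversary Bool) (n : ℕ)
    (hℓ : 1 ≤ ℓ n) :
    |prfIdealProb ℓ ℓ 𝒜 n - idealMaskFnProb ℓ 𝒜 n| ≤
      ((𝒜.fuel.eval n : ℕ) : ℝ) ^ 2 / (maskSet (ℓ n)).card := by
  have hS := maskSet_nonempty hℓ
  have hcardS : (0 : ℝ) < (maskSet (ℓ n)).card := by exact_mod_cast hS.card_pos
  unfold idealMaskFnProb
  refine abs_sub_avg_le hS ?_
  -- every mask term, as an average over the coins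
  rw [prfIdealProb_eq_avg]
  simp_rw [idealMaskFn_term_eq_avg]
  set c := 𝒜.coins.eval (unaryEncodeNat n).length with hc
  set K := 𝒜.fuel.eval (unaryEncodeNat n).length with hK
  have hKn : K = 𝒜.fuel.eval n := by rw [hK, length_unaryEncodeNat_mask]
  have hNpos : (0 : ℝ) < 2 ^ c := by positivity
  -- swap: sum over masks of |avg over coins| ≤ avg over coins of sum over masks
  calc ∑ s ∈ maskSet (ℓ n),
        |(∑ r : List.Vector Bool c, prF (fun _ => none)
            (fun h : List.Vector Bool (ℓ n) → List.Vector Bool (ℓ n) =>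
              𝒜.alg.runAux (oracleOfTable h) (boolPair (unaryEncodeNat n) r.toList) K [] = some true)) /
            2 ^ c -
          (∑ r : List.Vector Bool c, prF (fun _ => none)
            (fun h : List.Vector Bool (ℓ n) → List.Vector Bool (ℓ n) =>
              𝒜.alg.runAux (oracleOfTable (h ∘ repV s)) (boolPair (unaryEncodeNat n) r.toList) K [] =
                some true)) / 2 ^ c|
      = ∑ s ∈ maskSet (ℓ n), |∑ r : List.Vector Bool c,
          (prF (fun _ => none) (fun h : List.Vector Bool (ℓ n) → List.Vector Bool (ℓ n) =>
              𝒜.alg.runAux (oracleOfTable h) (boolPair (unaryEncodeNat n) r.toList) K [] = some true) -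
            prF (fun _ => none) (fun h : List.Vector Bool (ℓ n) → List.Vector Bool (ℓ n) =>
              𝒜.alg.runAux (oracleOfTable (h ∘ repV s)) (boolPair (unaryEncodeNat n) r.toList) K [] =
                some true))| / 2 ^ c := by
        refine Finset.sum_congr rfl fun s _ => ?_
        rw [← sub_div, ← Finset.sum_sub_distrib, abs_div, abs_of_pos hNpos]
    _ ≤ ∑ s ∈ maskSet (ℓ n), (∑ r : List.Vector Bool c,
          |prF (fun _ => none) (fun h : List.Vector Bool (ℓ n) → List.Vector Bool (ℓ n) =>
              𝒜.alg.runAux (oracleOfTable h) (boolPair (unaryEncodeNat n) r.toList) K [] = some true) -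
            prF (fun _ => none) (fun h : List.Vector Bool (ℓ n) → List.Vector Bool (ℓ n) =>
              𝒜.alg.runAux (oracleOfTable (h ∘ repV s)) (boolPair (unaryEncodeNat n) r.toList) K [] =
                some true)|) / 2 ^ c := by
        refine Finset.sum_le_sum fun s _ => div_le_div_of_nonneg_right ?_ hNpos.le
        exact Finset.abs_sum_le_sum_abs _ _
    _ = (∑ r : List.Vector Bool c, ∑ s ∈ maskSet (ℓ n),
          |prF (fun _ => none) (fun h : List.Vector Bool (ℓ n) → List.Vector Bool (ℓ n) =>
              𝒜.alg.runAux (oracleOfTable h) (boolPair (unaryEncodeNat n) r.toList) K [] = some true) -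
            prF (fun _ => none) (fun h : List.Vector Bool (ℓ n) → List.Vector Bool (ℓ n) =>
              𝒜.alg.runAux (oracleOfTable (h ∘ repV s)) (boolPair (unaryEncodeNat n) r.toList) K [] =
                some true)|) / 2 ^ c := by
        rw [← Finset.sum_div, Finset.sum_comm]
    _ ≤ (∑ _r : List.Vector Bool c, ((K : ℝ) ^ 2 / (maskSet (ℓ n)).card) * (maskSet (ℓ n)).card) /
          2 ^ c := by
        refine div_le_div_of_nonneg_right (Finset.sum_le_sum fun r _ => ?_) hNpos.le
        have h := avg_abs_prF_sub_prF_rep_le 𝒜.alg (boolPair (unaryEncodeNat n) r.toList)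
          {o | o = some true} K (maskSet (ℓ n)) hS
        rw [div_le_iff₀ hcardS] at h
        simpa only [Set.mem_setOf_eq] using h
    _ = ((𝒜.fuel.eval n : ℕ) : ℝ) ^ 2 / (maskSet (ℓ n)).card * (maskSet (ℓ n)).card := by
        rw [Finset.sum_const, Finset.card_univ, card_vector, Fintype.card_bool, nsmul_eq_mul, hKn]
        push_cast
        field_simp

/-- **Leg 4 (switching under the mask): masked random function versus masked random permutation.**
`|idealMaskFnProb − idealMaskPermProb| ≤ fuel(n)²/2^{ℓ n}`. [cite: Goldreich2001, Prop. 3.7.3 (p. 201)] -/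
theorem abs_idealMaskFnProb_sub_idealMaskPermProb_le (ℓ : ℕ → ℕ) (𝒜 : OracleAdversary Bool) (n : ℕ)
    (hℓ : 1 ≤ ℓ n) :
    |idealMaskFnProb ℓ 𝒜 n - idealMaskPermProb ℓ 𝒜 n| ≤
      ((𝒜.fuel.eval n : ℕ) : ℝ) ^ 2 / 2 ^ ℓ n := by
  have hS := maskSet_nonempty hℓ
  have hcardS : (0 : ℝ) < (maskSet (ℓ n)).card := by exact_mod_cast hS.card_pos
  unfold idealMaskFnProb idealMaskPermProb
  rw [← sub_div, ← Finset.sum_sub_distrib, abs_div, abs_of_pos hcardS, div_le_iff₀ hcardS]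
  simp_rw [idealMaskFn_term_eq_avg, idealMaskPerm_term_eq_avg]
  set c := 𝒜.coins.eval (unaryEncodeNat n).length with hc
  set K := 𝒜.fuel.eval (unaryEncodeNat n).length with hK
  have hKn : K = 𝒜.fuel.eval n := by rw [hK, length_unaryEncodeNat_mask]
  have hNpos : (0 : ℝ) < 2 ^ c := by positivity
  calc |∑ s ∈ maskSet (ℓ n),
        ((∑ r : List.Vector Bool c, prF (fun _ => none)
            (fun h : List.Vector Bool (ℓ n) → List.Vector Bool (ℓ n) =>
              𝒜.alg.runAux (oracleOfTable (h ∘ repV s)) (boolPair (unaryEncodeNat n) r.toList) K [] =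
                some true)) / 2 ^ c -
          (∑ r : List.Vector Bool c, prP (fun _ => none)
            (fun h : List.Vector Bool (ℓ n) → List.Vector Bool (ℓ n) =>
              𝒜.alg.runAux (oracleOfTable (h ∘ repV s)) (boolPair (unaryEncodeNat n) r.toList) K [] =
                some true)) / 2 ^ c)|
      ≤ ∑ s ∈ maskSet (ℓ n), (∑ r : List.Vector Bool c,
          |prF (fun _ => none) (fun h : List.Vector Bool (ℓ n) → List.Vector Bool (ℓ n) =>
              𝒜.alg.runAux (oracleOfTable (h ∘ repV s)) (boolPair (unaryEncodeNat n) r.toList) K [] =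
                some true) -
            prP (fun _ => none) (fun h : List.Vector Bool (ℓ n) → List.Vector Bool (ℓ n) =>
              𝒜.alg.runAux (oracleOfTable (h ∘ repV s)) (boolPair (unaryEncodeNat n) r.toList) K [] =
                some true)|) / 2 ^ c := by
        refine (Finset.abs_sum_le_sum_abs _ _).trans (Finset.sum_le_sum fun s _ => ?_)
        rw [← sub_div, ← Finset.sum_sub_distrib, abs_div, abs_of_pos hNpos]
        exact div_le_div_of_nonneg_right (Finset.abs_sum_le_sum_abs _ _) hNpos.le
    _ ≤ ∑ _s ∈ maskSet (ℓ n), (∑ _r : List.Vector Bool c, (K : ℝ) ^ 2 / 2 ^ ℓ n) / 2 ^ c := by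
        refine Finset.sum_le_sum fun s _ => div_le_div_of_nonneg_right
          (Finset.sum_le_sum fun r _ => ?_) hNpos.le
        have h := abs_prF_sub_prP_rep_le_root 𝒜.alg (boolPair (unaryEncodeNat n) r.toList)
          {o | o = some true} K s
        simpa only [Set.mem_setOf_eq] using h
    _ = ((𝒜.fuel.eval n : ℕ) : ℝ) ^ 2 / 2 ^ ℓ n * (maskSet (ℓ n)).card := by
        rw [Finset.sum_const, Finset.sum_const, Finset.card_univ, card_vector, Fintype.card_bool,
          nsmul_eq_mul, nsmul_eq_mul, hKn]
        push_cast
        field_simp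


/-! ### The query translation: "if the head bit is `1`, XOR with `1·m`" as a string brick -/

section Brick

open Complexity.Brick Complexity.Plumb Complexity.HashBricks

/-- `(l ⇂ j)` starts with `l[j]` (default `false`). [folklore] -/
private theorem headD_drop_eq_getD (l : List Bool) (j : ℕ) : (l.drop j).headD false = l.getD j false := by
  induction l generalizing j with
  | nil => simp
  | cons b l ih => cases j <;> simp [*]

/-- **Positionwise XOR with a padded mask**: `xorPad q s = [q[j] ⊕ s[j]]_{j < |q|}` (`s` read with
default `0` beyond its end), of the length of `q`; for `|s| = |q|` this is `xorStr q s`.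
[cite: ServedioGortler2004, §6] -/
def xorPad (q s : List Bool) : List Bool :=
  ccat (fun j => [xor (q.getD j false) (s.getD j false)]) q.length

/-- `ccat` of one-symbol pieces has as many symbols as pieces. [folklore] -/
theorem length_ccat_singleton (f : ℕ → Bool) : ∀ k : ℕ, (ccat (fun j => [f j]) k).length = k
  | 0 => rfl
  | k + 1 => by rw [ccat_succ, List.length_append, length_ccat_singleton f k, List.length_singleton]

/-- `xorPad` has the length of its first argument. [folklore] -/
@[simp] theorem length_xorPad (q s : List Bool) : (xorPad q s).length = q.length :=
  length_ccat_singleton _ _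

/-- `ccat` of singletons is a `zipWith` with `range`. [folklore] -/
theorem ccat_singleton_eq_map (f : ℕ → Bool) : ∀ k : ℕ, ccat (fun j => [f j]) k = (List.range k).map f
  | 0 => rfl
  | k + 1 => by rw [ccat_succ, ccat_singleton_eq_map f k, List.range_succ, List.map_append, List.map_singleton]

/-- On a mask of the same length, `xorPad` is `xorStr` (the positionwise XOR). [folklore] -/
theorem xorPad_eq_xorStr {q s : List Bool} (h : q.length = s.length) : xorPad q s = xorStr q s := by
  rw [xorStr, if_pos h, xorPad, ccat_singleton_eq_map]
  apply List.ext_getElem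
  · simp [h]
  · intro j h1 h2
    rw [List.length_map, List.length_range] at h1
    have hjs : j < s.length := h ▸ h1
    simp only [List.getElem_map, List.getElem_range, List.getElem_zipWith]
    rw [List.getD_eq_getElem _ _ h1, List.getD_eq_getElem _ _ hjs]

/-- `xorPad` only reads the first `|q|` symbols of the mask. [folklore] -/
theorem xorPad_take (q s : List Bool) : xorPad q (s.take q.length) = xorPad q s := by
  unfold xorPad
  refine ccat_congr fun j hj => ?_
  simp only [List.getD_eq_getElem?_getD, List.getElem?_take_of_lt hj]

/-- **The translation applied by the mask adversary**: with the coin string `r'`, a query `q` whose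
head bit is `1` becomes `q ⊕ (1 · r')` (positionwise, over the length of `q`), and is unchanged
otherwise — so a query of length `a ≤ |r'| + 1` becomes `rep_{1·(r' ↾ (a−1))} q` (`transQ_eq_repStr`).
[cite: ServedioGortler2004, §6] -/
def transQ (r' q : List Bool) : List Bool :=
  if q.headD false then xorPad q (true :: r') else q

/-- `transQ` preserves the length. [folklore] -/
@[simp] theorem length_transQ (r' q : List Bool) : (transQ r' q).length = q.length := by
  unfold transQ; split_ifs <;> simp

/-- **On a query of length `a ≤ |r'| + 1` the translation is the representative map of the mask
`1 · (r' ↾ (a − 1))`.** [cite: ServedioGortler2004, §6] -/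
theorem transQ_eq_repStr {r' q : List Bool} {a : ℕ} (hq : q.length = a) (ha : a ≤ r'.length + 1) :
    transQ r' q = repStr (true :: r'.take (a - 1)) q := by
  rcases q with _ | ⟨b, q⟩
  · simp [transQ, repStr]
  · have hlen : (b :: q).length = (true :: r'.take (a - 1)).length := by
      simp only [List.length_cons, List.length_take]
      simp only [List.length_cons] at hq
      omega
    cases b
    · rfl
    · show xorPad (true :: q) (true :: r') = xorStr (true :: q) (true :: r'.take (a - 1))
      rw [← xorPad_eq_xorStr hlen, ← xorPad_take (true :: q) (true :: r'),
        ← xorPad_take (true :: q) (true :: r'.take (a - 1))]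
      congr 1
      simp only [List.length_cons, List.take_succ_cons, List.take_take]
      congr 2
      simp only [List.length_cons] at hq
      omega

/-- **An oracle answering only at length `a` sees the translated queries as the queries through
`rep_s`, `s = 1 · (r' ↾ (a−1))`** (ill-formed queries stay ill-formed: the translation preserves
lengths). [folklore] -/
theorem oracle_transQ_eq {O : Oracle} {a : ℕ} (hO : ∀ q : List Bool, q.length ≠ a → O q = [])
    {r' : List Bool} (ha : a ≤ r'.length + 1) (q : List Bool) :
    O (transQ r' q) = O (repStr (true :: r'.take (a - 1)) q) := by
  by_cases hq : q.length = a
  · rw [transQ_eq_repStr hq ha]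
  · rw [hO _ (by rw [length_transQ]; exact hq), hO _ (by rw [length_repStr]; exact hq)]

/-- The XOR piece on `⟨⟨q, s⟩, 1ʲ⟩`: the one-bit string `[q[j] ⊕ s[j]]`. [folklore] -/
def xorPiece : List Bool → List Bool :=
  xorFn (headBitFn ∘ bitAtFn ∘ fanoutFn sndF (fstF ∘ fstF))
    (headBitFn ∘ bitAtFn ∘ fanoutFn sndF (sndF ∘ fstF))

/-- Value of the XOR piece. [folklore] -/
theorem xorPiece_apply (q s : List Bool) (j : ℕ) :
    xorPiece (boolPair (boolPair q s) (ones j)) = [xor (q.getD j false) (s.getD j false)] := by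
  have h1 : (headBitFn ∘ bitAtFn ∘ fanoutFn sndF (fstF ∘ fstF)) (boolPair (boolPair q s) (ones j)) =
      [q.getD j false] := by
    simp only [Function.comp_apply, fanoutFn_apply, sndF_boolPair, fstF_boolPair, bitAtFn_boolPair,
      headBitFn_apply, List.length_replicate]
    rw [← headD_drop_eq_getD]
    cases q.drop j <;> simp
  have h2 : (headBitFn ∘ bitAtFn ∘ fanoutFn sndF (sndF ∘ fstF)) (boolPair (boolPair q s) (ones j)) =
      [s.getD j false] := by
    simp only [Function.comp_apply, fanoutFn_apply, sndF_boolPair, fstF_boolPair, bitAtFn_boolPair,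
      headBitFn_apply, List.length_replicate]
    rw [← headD_drop_eq_getD]
    cases s.drop j <;> simp
  rw [xorPiece, xorFn_apply h1 h2]

/-- The XOR piece is one symbol long on every input. [folklore] -/
theorem length_xorPiece (z : List Bool) : (xorPiece z).length = 1 := by
  obtain ⟨b, hb⟩ := oneBit_xorFn (c := headBitFn ∘ bitAtFn ∘ fanoutFn sndF (fstF ∘ fstF))
    (d := headBitFn ∘ bitAtFn ∘ fanoutFn sndF (sndF ∘ fstF))
    (fun w => ⟨_, headBitFn_apply _⟩) (fun w => ⟨_, headBitFn_apply _⟩) z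
  rw [xorPiece, hb, List.length_singleton]

/-- `xorPiece ∈ FP`. [folklore] -/
private theorem xorPiece_mem_FP : xorPiece ∈ FP :=
  xorFn_mem_FP
    (comp_mem_FP headBitFn_mem_FP (comp_mem_FP bitAtFn_mem_FP
      (fanoutFn_mem_FP sndF_mem_FP (comp_mem_FP fstF_mem_FP fstF_mem_FP))))
    (comp_mem_FP headBitFn_mem_FP (comp_mem_FP bitAtFn_mem_FP
      (fanoutFn_mem_FP sndF_mem_FP (comp_mem_FP sndF_mem_FP fstF_mem_FP))))

/-- **The positionwise-XOR brick** `xorPadFn ⟨q, s⟩ = xorPad q s`: a counted fold of the XOR pieces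
(the pattern of `rawBitsFn` / `HardLang.xorF`). [cite: AroraBarak2009, §1.3 (bounded loops)] -/
def xorPadFn : List Bool → List Bool :=
  sndPow 2 ∘ foldLoop appF (clipF 1 xorPiece) Polynomial.X ∘
    fanoutFn id (fanoutFn (lenBinF ∘ fstF) (fun _ => boolPair [] []))

/-- **Value of `xorPadFn`.** [folklore] -/
theorem xorPadFn_boolPair (q s : List Bool) : xorPadFn (boolPair q s) = xorPad q s := by
  have hk : q.length ≤ Polynomial.X.eval (boolPair q s).length := by
    rw [Polynomial.eval_X, length_boolPair]; omega
  rw [xorPadFn, Function.comp_apply, Function.comp_apply, fanoutFn_apply, fanoutFn_apply, id,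
    Function.comp_apply, fstF_boolPair, lenBinF_apply,
    show boolPair ([] : List Bool) [] = boolPair (ones 0) ([] : List Bool) by rfl,
    foldLoop_apply _ _ hk, foldAcc_clipF (fun j _ _ => by rw [length_xorPiece]; omega),
    foldAcc_appF]
  simp only [sndPow_succ_boolPair, sndPow_zero_boolPair, List.nil_append, Nat.zero_add, xorPiece_apply]
  rfl

/-- **`xorPadFn ∈ FP`.** [cite: AroraBarak2009, §1.3] -/
theorem xorPadFn_mem_FP : xorPadFn ∈ FP :=
  comp_mem_FP (sndPow_mem_FP 2) (comp_mem_FP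
    (foldLoop_clipF_mem_FP 1 appF_mem_FP length_appF_le xorPiece_mem_FP Polynomial.X)
    (fanoutFn_mem_FP Complexity.OracleCompose.id_mem_FP
      (fanoutFn_mem_FP (comp_mem_FP lenBinF_mem_FP fstF_mem_FP) (const_mem_FP _))))

/-- **The query translation brick** on the argument `⟨x', ⟨e, q⟩⟩` of `OracleAlg.mapQuery`
(`x' = ⟨1ⁿ, r'⟩` the input of the adversary, `e` the coded transcript, `q` the query):
`transQ r' q`. [cite: AroraBarak2009, §3.4] -/
def transFn : List Bool → List Bool :=
  iteFn (headBitFn ∘ (sndF ∘ sndF))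
    (xorPadFn ∘ fanoutFn (sndF ∘ sndF) (List.cons true ∘ sndF ∘ fstF)) (sndF ∘ sndF)

/-- **Value of `transFn`.** [folklore] -/
theorem transFn_apply (u r' e q : List Bool) :
    transFn (boolPair (boolPair u r') (boolPair e q)) = transQ r' q := by
  have hc : (headBitFn ∘ (sndF ∘ sndF)) (boolPair (boolPair u r') (boolPair e q)) = [q.headD false] := by
    simp
  rw [transFn, iteFn_apply hc, transQ]
  cases q.headD false
  · simp
  · simp only [if_true, Function.comp_apply, fanoutFn_apply, sndF_boolPair, fstF_boolPair]
    exact xorPadFn_boolPair q (true :: r')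

/-- **`transFn ∈ FP`.** [cite: AroraBarak2009, §1.3] -/
theorem transFn_mem_FP : transFn ∈ FP :=
  iteFn_mem_FP (comp_mem_FP headBitFn_mem_FP (comp_mem_FP sndF_mem_FP sndF_mem_FP))
    (comp_mem_FP xorPadFn_mem_FP (fanoutFn_mem_FP (comp_mem_FP sndF_mem_FP sndF_mem_FP)
      (comp_mem_FP (cons_mem_FP true) (comp_mem_FP sndF_mem_FP fstF_mem_FP))))
    (comp_mem_FP sndF_mem_FP sndF_mem_FP)

end Brick

/-! ### The mask adversary -/

namespace OracleAdversary

/-- **The mask adversary** of `𝒜` with coin pad `B`: it takes `B(n)` extra coins `m` in front of the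
coins of `𝒜`, runs `𝒜` on `⟨1ⁿ, coins⟩` (input pre-processing by the coin splitter `dropSndFn B`,
`OracleAlg.comap`) and translates every query by `transFn` ("XOR with `1·m` if the head bit is `1`",
`OracleAlg.mapQuery`); same round budget. [cite: AaronsonChen2017, App. 13 (p. 42: "otherwise we can directly construct a distinguisher")] [cite: AroraBarak2009, §3.4] -/
def maskAdv (𝒜 : OracleAdversary Bool) (B : Polynomial ℕ) : OracleAdversary Bool where
  alg := (𝒜.alg.comap (dropSndFn B)).mapQuery transFn
  coins := B + 𝒜.coins
  fuel := 𝒜.fuel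

/-- **The mask adversary is PPT** when `𝒜` is (`isPolyTime_comap`, `isPolyTime_mapQuery`, the bricks
`dropSndFn B`, `transFn` being in `FP`). [cite: AroraBarak2009, §3.4] -/
theorem isPPT_maskAdv {𝒜 : OracleAdversary Bool} (h : 𝒜.IsPPT encodingBoolBool) (B : Polynomial ℕ) :
    (𝒜.maskAdv B).IsPPT encodingBoolBool :=
  OracleAlg.isPolyTime_mapQuery (eb := encodingBoolBool)
    (OracleAlg.isPolyTime_comap (eb := encodingBoolBool) h (dropSndFn_mem_FP B)) transFn_mem_FP

/-- **The run of the mask adversary**: on `⟨u, r'⟩` against `O` it is the run of `𝒜` on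
`⟨u, r' ⇂ B(|u|)⟩` against the translated oracle `q ↦ O (transQ r' q)`. [cite: AroraBarak2009, §3.4] -/
theorem run_maskAdv (𝒜 : OracleAdversary Bool) (B : Polynomial ℕ) (O : Oracle) (u r' : List Bool) (k : ℕ) :
    (𝒜.maskAdv B).alg.run O k (boolPair u r') =
      𝒜.alg.run (fun q => O (transQ r' q)) k (boolPair u (r'.drop (B.eval u.length))) := by
  have hagree : OracleAlg.MapAgree (𝒜.alg.comap (dropSndFn B)) transFn O
      (fun q => O (transQ r' q)) (boolPair u r') := fun i q _ _ => by
    rw [transFn_apply]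
  rw [maskAdv, OracleAlg.run_mapQuery _ _ _ _ _ hagree, OracleAlg.run, OracleAlg.runAux_comap,
    dropSndFn_boolPair]
  rfl

end OracleAdversary


/-! ### Sums over coin strings: splitting, casting, prefixes -/

section CoinSums

/-- Appending two bit vectors, as an equivalence `{0,1}^p × {0,1}^q ≃ {0,1}^{p+q}`. [folklore] -/
def coinAppendEquiv (p q : ℕ) : List.Vector Bool p × List.Vector Bool q ≃ List.Vector Bool (p + q) where
  toFun x := ⟨x.1.toList ++ x.2.toList, by simp⟩
  invFun v := (⟨v.toList.take p, by simp⟩, ⟨v.toList.drop p, by simp⟩)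
  left_inv := fun ⟨a, b⟩ => by
    refine Prod.ext (List.Vector.eq _ _ ?_) (List.Vector.eq _ _ ?_)
    · show ((a.toList ++ b.toList).take p) = a.toList
      rw [List.take_append_of_le_length (by simp), List.take_of_length_le (by simp)]
    · show ((a.toList ++ b.toList).drop p) = b.toList
      rw [List.drop_append_of_le_length (by simp), List.drop_of_length_le (by simp), List.nil_append]
  right_inv := fun v => List.Vector.eq _ _ (by
    show (v.toList.take p) ++ (v.toList.drop p) = v.toList
    exact List.take_append_drop p v.toList)

/-- The appended vector reads as the concatenation (definitional). [folklore] -/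
@[simp] theorem toList_coinAppendEquiv {p q : ℕ} (x : List.Vector Bool p × List.Vector Bool q) :
    (coinAppendEquiv p q x).toList = x.1.toList ++ x.2.toList :=
  rfl

/-- **Splitting a sum over `{0,1}^{p+q}`** into the prefix and the suffix. [folklore] -/
theorem sum_coins_split (p q : ℕ) (f : List Bool → ℝ) :
    ∑ v : List.Vector Bool (p + q), f v.toList =
      ∑ a : List.Vector Bool p, ∑ b : List.Vector Bool q, f (a.toList ++ b.toList) := by
  rw [← Fintype.sum_prod_type', ← Fintype.sum_equiv (coinAppendEquiv p q) _ _ (fun _ => rfl)]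
  rfl

/-- Transport of a sum over `{0,1}^m` along `m = m'` (the summand reading the string only). [folklore] -/
private theorem sum_coins_cast {m m' : ℕ} (h : m = m') (f : List Bool → ℝ) :
    ∑ v : List.Vector Bool m, f v.toList = ∑ v : List.Vector Bool m', f v.toList := by
  subst h; rfl

/-- **A sum over `{0,1}^{p+q}` of a function of the first `p` symbols.** [folklore] -/
theorem sum_coins_take (p q : ℕ) (g : List Bool → ℝ) :
    ∑ v : List.Vector Bool (p + q), g (v.toList.take p) = 2 ^ q * ∑ t : List.Vector Bool p, g t.toList := by
  rw [sum_coins_split p q (fun l => g (l.take p)), Finset.mul_sum]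
  refine Fintype.sum_congr _ _ fun a => ?_
  have : ∀ b : List.Vector Bool q, g ((a.toList ++ b.toList).take p) = g a.toList := fun b => by
    rw [List.take_append_of_le_length (by simp), List.take_of_length_le (by simp)]
  simp only [this, Finset.sum_const, Finset.card_univ, card_vector, Fintype.card_bool, nsmul_eq_mul]
  push_cast; ring

/-- **The acceptance probability as an average of indicators over the coins.**
[cite: AroraBarak2009, Def. 7.1] -/
theorem acceptProb_eq_avg_coins (𝒜 : OracleAdversary Bool) (O : Oracle) (n : ℕ) :
    𝒜.acceptProb O n =
      (∑ r : List.Vector Bool (𝒜.coins.eval (unaryEncodeNat n).length),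
          if 𝒜.alg.run O (𝒜.fuel.eval (unaryEncodeNat n).length) (boolPair (unaryEncodeNat n) r.toList) =
              some true then (1 : ℝ) else 0) /
        2 ^ 𝒜.coins.eval (unaryEncodeNat n).length := by
  classical
  rw [OracleAdversary.acceptProb, outputPMF_toReal_eq_card, Finset.natCast_card_filter]

end CoinSums

/-! ### The acceptance probability of the mask adversary -/

namespace OracleAdversary

/-- **Against an oracle answering only at length `a ≤ B(n)`, the mask adversary accepts with the
average, over the masks of `{0,1}^a` with head bit `1`, of the acceptance probabilities of `𝒜`
against the masked oracle `O ∘ rep_s`** (the `B(n)` leading coins are uniform, the translation on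
length-`a` queries is `rep_{1·(m ↾ (a−1))}`, and the remaining coins are those of `𝒜`).
[cite: AaronsonChen2017, App. 13 (p. 42)] [cite: AroraBarak2009, §3.4, Def. 7.1] -/
theorem acceptProb_maskAdv (𝒜 : OracleAdversary Bool) (B : Polynomial ℕ) {O : Oracle} {a : ℕ}
    (hO : ∀ q : List Bool, q.length ≠ a → O q = []) (ha : 1 ≤ a) {n : ℕ} (haB : a ≤ B.eval n) :
    (𝒜.maskAdv B).acceptProb O n =
      (∑ s ∈ maskSet a, 𝒜.acceptProb (O ∘ repStr s.toList) n) / (maskSet a).card := by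
  classical
  obtain ⟨a, rfl⟩ : ∃ m, a = m + 1 := ⟨a - 1, by omega⟩
  rw [card_maskSet_succ, maskSet_succ_eq_image, Finset.sum_image (fun t _ t' _ h => by
    simpa using congrArg List.Vector.tail h)]
  -- abbreviations
  set x : List Bool := unaryEncodeNat n with hx
  set N : ℕ := x.length with hNdef
  have hN : N = n := unary_decode_encode_nat n
  set c : ℕ := 𝒜.coins.eval N with hc
  set K : ℕ := 𝒜.fuel.eval N with hK
  have hBN : a + 1 ≤ B.eval N := by rw [hN]; exact haB
  -- the indicator of acceptance of `𝒜` against the masked oracle of the mask `1·t`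
  set g : List Bool → ℝ := fun t => 𝒜.acceptProb (O ∘ repStr (true :: t)) n with hg
  -- Step 1: the mask adversary's acceptance as a sum over its coins `r' = m r`
  have h1 : (𝒜.maskAdv B).acceptProb O n =
      (∑ r' : List.Vector Bool (B.eval N + c),
          if 𝒜.alg.run (fun q => O (transQ r'.toList q)) K (boolPair x (r'.toList.drop (B.eval N))) =
              some true then (1 : ℝ) else 0) / 2 ^ (B.eval N + c) := by
    have hcoins : (𝒜.maskAdv B).coins.eval N = B.eval N + c := by
      simp [maskAdv, hc]
    rw [acceptProb_eq_avg_coins, ← hx, ← hNdef, hcoins]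
    congr 1
    refine Fintype.sum_congr _ _ fun r' => ?_
    rw [run_maskAdv]
    rfl
  -- Step 2: split the coins; the suffix is the coin string of `𝒜`, the translation only reads `m ↾ a`
  have h2 : ∑ r' : List.Vector Bool (B.eval N + c),
      (if 𝒜.alg.run (fun q => O (transQ r'.toList q)) K (boolPair x (r'.toList.drop (B.eval N))) =
          some true then (1 : ℝ) else 0) =
        ∑ m : List.Vector Bool (B.eval N), 2 ^ c * g (m.toList.take a) := by
    rw [sum_coins_split (B.eval N) c (fun l =>
      if 𝒜.alg.run (fun q => O (transQ l q)) K (boolPair x (l.drop (B.eval N))) = some true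
        then (1 : ℝ) else 0)]
    refine Fintype.sum_congr _ _ fun m => ?_
    have hm : m.toList.length = B.eval N := m.toList_length
    have hdrop : ∀ r : List.Vector Bool c, (m.toList ++ r.toList).drop (B.eval N) = r.toList := fun r => by
      rw [List.drop_append_of_le_length (by omega), List.drop_of_length_le (by omega), List.nil_append]
    have horacle : ∀ r : List.Vector Bool c,
        (fun q => O (transQ (m.toList ++ r.toList) q)) = O ∘ repStr (true :: m.toList.take a) := by
      intro r
      funext q
      rw [Function.comp_apply, oracle_transQ_eq hO (by simp; omega) q, Nat.add_sub_cancel,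
        List.take_append_of_le_length (by omega)]
    simp only [hdrop, horacle]
    show _ = 2 ^ c * 𝒜.acceptProb (O ∘ repStr (true :: m.toList.take a)) n
    rw [acceptProb_eq_avg_coins, ← hx, ← hNdef, ← hc, ← hK, mul_div_cancel₀ _ (by positivity)]
  -- Step 3: the sum over `m` only reads the first `a` coins
  have h3 : ∑ m : List.Vector Bool (B.eval N), 2 ^ c * g (m.toList.take a) =
      2 ^ c * (2 ^ (B.eval N - a) * ∑ t : List.Vector Bool a, g t.toList) := by
    rw [← Finset.mul_sum, sum_coins_cast (show B.eval N = a + (B.eval N - a) by omega)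
      (f := fun l => g (l.take a)), sum_coins_take]
  -- Step 4: assemble
  rw [h1, h2, h3]
  have hsum : ∑ t : List.Vector Bool a, g t.toList =
      ∑ t : List.Vector Bool a, 𝒜.acceptProb (O ∘ repStr (List.Vector.cons true t).toList) n := by
    refine Fintype.sum_congr _ _ fun t => ?_
    rw [hg]
    congr 2
  rw [hsum]
  have h2a : (2 : ℝ) ^ (B.eval N + c) = 2 ^ c * 2 ^ (B.eval N - a) * 2 ^ a := by
    rw [← pow_add, ← pow_add]; congr 1; omega
  rw [h2a]
  push_cast
  field_simp

end OracleAdversary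


/-! ### The computational leg: the two games of the mask adversary -/

section MaskAdvGames

variable {F : FunctionEnsemble} {κ ℓ : ℕ → ℕ}

/-- Masking inside a length-`a` function oracle: `oracleOfFnAt a f ∘ rep_s = oracleOfFnAt a (f ∘ rep_s)`
(the translation preserves lengths). [folklore] -/
theorem oracleOfFnAt_comp_repStr (a : ℕ) (f : List Bool → List Bool) (s : List Bool) :
    oracleOfFnAt a f ∘ repStr s = oracleOfFnAt a (f ∘ repStr s) := by
  funext q
  simp only [Function.comp_apply, oracleOfFnAt, length_repStr]

/-- **The real game of the mask adversary is the real mask game of `𝒜`**: for block length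
`1 ≤ ℓ n ≤ B n`, `prfRealProb F κ ℓ (𝒜.maskAdv B) n = maskRealProb F κ ℓ 𝒜 n`.
[cite: AaronsonChen2017, App. 13 (p. 42)] -/
theorem prfRealProb_maskAdv (F : FunctionEnsemble) (κ ℓ : ℕ → ℕ) (𝒜 : OracleAdversary Bool)
    {B : Polynomial ℕ} {n : ℕ} (hℓ1 : 1 ≤ ℓ n) (hℓB : ℓ n ≤ B.eval n) :
    prfRealProb F κ ℓ (𝒜.maskAdv B) n = maskRealProb F κ ℓ 𝒜 n := by
  rw [prfRealProb_eq_sum, maskRealProb]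
  have key : ∀ k : List.Vector Bool (κ n),
      (𝒜.maskAdv B).acceptProb (oracleOfFnAt (ℓ n) (F n k.toList)) n =
        (∑ s ∈ maskSet (ℓ n), 𝒜.acceptProb (oracleOfFnAt (ℓ n) (F n k.toList ∘ repStr s.toList)) n) /
          (maskSet (ℓ n)).card := fun k => by
    rw [OracleAdversary.acceptProb_maskAdv 𝒜 B (fun q hq => oracleOfFnAt_apply_of_length_ne _ hq) hℓ1 hℓB]
    simp_rw [oracleOfFnAt_comp_repStr]
  simp_rw [key]
  rw [← Finset.sum_div, div_div, mul_comm]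

/-- A bind over a finite type, read off at one outcome, as a finite weighted sum. [folklore] -/
theorem bind_outputPMF_toReal_eq_sum {γ : Type} [Fintype γ] (μ : PMF γ) (𝒜 : OracleAdversary Bool)
    (G : γ → Oracle) (n : ℕ) :
    ((μ.bind fun c => 𝒜.outputPMF (G c) (unaryEncodeNat n)) (some true)).toReal =
      ∑ c, (μ c).toReal * 𝒜.acceptProb (G c) n := by
  rw [PMF.bind_apply, tsum_fintype, ENNReal.toReal_sum (fun a _ =>
    ENNReal.mul_ne_top (PMF.apply_ne_top _ _) (PMF.apply_ne_top _ _))]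
  refine Finset.sum_congr rfl fun c _ => ?_
  rw [ENNReal.toReal_mul]
  rfl

/-- **The ideal permutation game of the mask adversary is the ideal mask game of `𝒜`**: for block
length `1 ≤ ℓ n ≤ B n`, `prpIdealProb ℓ (𝒜.maskAdv B) n = idealMaskPermProb ℓ 𝒜 n`.
[cite: AaronsonChen2017, App. 13 (p. 42)] -/
theorem prpIdealProb_maskAdv (ℓ : ℕ → ℕ) (𝒜 : OracleAdversary Bool) {B : Polynomial ℕ} {n : ℕ}
    (hℓ1 : 1 ≤ ℓ n) (hℓB : ℓ n ≤ B.eval n) :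
    prpIdealProb ℓ (𝒜.maskAdv B) n = idealMaskPermProb ℓ 𝒜 n := by
  classical
  rw [prpIdealProb_eq_tsum, tsum_fintype, idealMaskPermProb]
  simp_rw [bind_outputPMF_toReal_eq_sum]
  have key : ∀ σ : Equiv.Perm (List.Vector Bool (ℓ n)),
      (𝒜.maskAdv B).acceptProb (oracleOfTable σ) n =
        (∑ s ∈ maskSet (ℓ n), 𝒜.acceptProb (oracleOfTable (σ ∘ repV s)) n) / (maskSet (ℓ n)).card :=
    fun σ => by
    rw [OracleAdversary.acceptProb_maskAdv 𝒜 B (fun q hq => oracleOfTable_apply_of_length_ne _ hq) hℓ1 hℓB]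
    simp_rw [← oracleOfTable_comp_repV]
  simp_rw [key, mul_div_assoc', ← Finset.sum_div, Finset.mul_sum]
  rw [Finset.sum_comm]

end MaskAdvGames

/-! ### The theorem: the masked PRP is indistinguishable from the PRP -/

/-- `p(n)²/2^{ℓ n} ≤ p(n)²/2ⁿ` when `n ≤ ℓ n`. [folklore] -/
theorem natPoly_sq_div_two_pow_le {ℓ : ℕ → ℕ} (hℓ : ∀ n, n ≤ ℓ n) (p : Polynomial ℕ) (n : ℕ) :
    ((p.eval n : ℕ) : ℝ) ^ 2 / 2 ^ ℓ n ≤ ((p.eval n : ℕ) : ℝ) ^ 2 / 2 ^ n :=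
  div_le_div_of_nonneg_left (by positivity) (by positivity) (pow_le_pow_right₀ (by norm_num) (hℓ n))

/-- **A classically secure PRP composed with a hidden XOR-mask representative is indistinguishable
from the PRP** (the XOR-mask analogue of Aaronson–Chen's Lemma 7.5 (1): "no classical algorithm can
distinguish them with a non-negligible advantage"). For a secure `PRP^raw = (F, κ, ℓ)` with
`ℓ n ≥ n` and every PPT oracle adversary `𝒜`, the difference of the acceptance probabilities
against `PRP^raw_k` (`k` uniform) and against `PRP^raw_k ∘ rep_s` (`k`, `s` uniform, `s` with head
bit `1`) is negligible: the five-game hybrid of the module docstring, with the error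
`prpAdv(𝒜) + prpAdv(𝒜.maskAdv B) + 4·fuel(n)²/2ⁿ` from `n ≥ 1` on.
[cite: AaronsonChen2017, Lemma 7.5 (1) (p. 30) and App. 13 (p. 42)] [cite: ServedioGortler2004, Thm. 6.1 (ii)] -/
theorem maskedPRP_indist {F : FunctionEnsemble} {κ ℓ : ℕ → ℕ} (hF : IsPRP F κ ℓ) (hℓ : ∀ n, n ≤ ℓ n)
    {𝒜 : OracleAdversary Bool} (h𝒜 : 𝒜.IsPPT encodingBoolBool) :
    SuperpolynomialDecay atTop (fun n : ℕ => (n : ℝ))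
      (fun n => |prfRealProb F κ ℓ 𝒜 n - maskRealProb F κ ℓ 𝒜 n|) := by
  -- the coin pad: a polynomial bound on the block length
  obtain ⟨B, hB⟩ := hF.isEfficientFamily.2.1
  have hℓB : ∀ n, ℓ n ≤ B.eval n := fun n => (hB n).2.1
  have h𝒜' : (𝒜.maskAdv B).IsPPT encodingBoolBool := OracleAdversary.isPPT_maskAdv h𝒜 B
  -- the decaying bound
  have hdec : SuperpolynomialDecay atTop (fun n : ℕ => (n : ℝ)) (fun n =>
      prpAdvantage F κ ℓ 𝒜 n + prpAdvantage F κ ℓ (𝒜.maskAdv B) n +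
        4 * (((𝒜.fuel.eval n : ℕ) : ℝ) ^ 2 / 2 ^ n)) :=
    ((hF.superpolynomialDecay h𝒜).add (hF.superpolynomialDecay h𝒜')).add
      ((superpolynomialDecay_natPoly_sq_div_two_pow 𝒜.fuel).const_mul 4)
  refine hdec.trans_eventually_abs_le ?_
  filter_upwards [eventually_ge_atTop 1] with n hn
  have hℓ1 : 1 ≤ ℓ n := hn.trans (hℓ n)
  simp only [Function.comp_apply, abs_abs]
  -- the five legs
  have h1 : |prfRealProb F κ ℓ 𝒜 n - prpIdealProb ℓ 𝒜 n| = prpAdvantage F κ ℓ 𝒜 n := rfl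
  have h2 : |prpIdealProb ℓ 𝒜 n - prfIdealProb ℓ ℓ 𝒜 n| ≤ ((𝒜.fuel.eval n : ℕ) : ℝ) ^ 2 / 2 ^ n :=
    (abs_prpIdealProb_sub_prfIdealProb_le ℓ 𝒜 n).trans (natPoly_sq_div_two_pow_le hℓ _ n)
  have h3 : |prfIdealProb ℓ ℓ 𝒜 n - idealMaskFnProb ℓ 𝒜 n| ≤ 2 * (((𝒜.fuel.eval n : ℕ) : ℝ) ^ 2 / 2 ^ n) := by
    refine (abs_prfIdealProb_sub_idealMaskFnProb_le ℓ 𝒜 n hℓ1).trans ?_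
    rw [card_maskSet hℓ1, mul_div_assoc', div_le_div_iff₀ (by positivity) (by positivity)]
    have h2pow : (2 : ℝ) ^ n ≤ 2 * (2 : ℝ) ^ (ℓ n - 1) := by
      rw [← pow_succ']
      exact pow_le_pow_right₀ (by norm_num) (by have := hℓ n; omega)
    push_cast
    nlinarith [sq_nonneg ((𝒜.fuel.eval n : ℕ) : ℝ), h2pow]
  have h4 : |idealMaskFnProb ℓ 𝒜 n - idealMaskPermProb ℓ 𝒜 n| ≤ ((𝒜.fuel.eval n : ℕ) : ℝ) ^ 2 / 2 ^ n :=
    (abs_idealMaskFnProb_sub_idealMaskPermProb_le ℓ 𝒜 n hℓ1).trans (natPoly_sq_div_two_pow_le hℓ _ n)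
  have h5 : |idealMaskPermProb ℓ 𝒜 n - maskRealProb F κ ℓ 𝒜 n| = prpAdvantage F κ ℓ (𝒜.maskAdv B) n := by
    rw [← prpIdealProb_maskAdv ℓ 𝒜 hℓ1 (hℓB n), ← prfRealProb_maskAdv F κ ℓ 𝒜 hℓ1 (hℓB n),
      prpAdvantage, abs_sub_comm]
  -- triangle inequality
  have htri : |prfRealProb F κ ℓ 𝒜 n - maskRealProb F κ ℓ 𝒜 n| ≤
      |prfRealProb F κ ℓ 𝒜 n - prpIdealProb ℓ 𝒜 n| + |prpIdealProb ℓ 𝒜 n - prfIdealProb ℓ ℓ 𝒜 n| +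
        |prfIdealProb ℓ ℓ 𝒜 n - idealMaskFnProb ℓ 𝒜 n| + |idealMaskFnProb ℓ 𝒜 n - idealMaskPermProb ℓ 𝒜 n| +
          |idealMaskPermProb ℓ 𝒜 n - maskRealProb F κ ℓ 𝒜 n| := by
    have t1 := abs_sub_le (prfRealProb F κ ℓ 𝒜 n) (prpIdealProb ℓ 𝒜 n) (maskRealProb F κ ℓ 𝒜 n)
    have t2 := abs_sub_le (prpIdealProb ℓ 𝒜 n) (prfIdealProb ℓ ℓ 𝒜 n) (maskRealProb F κ ℓ 𝒜 n)
    have t3 := abs_sub_le (prfIdealProb ℓ ℓ 𝒜 n) (idealMaskFnProb ℓ 𝒜 n) (maskRealProb F κ ℓ 𝒜 n)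
    have t4 := abs_sub_le (idealMaskFnProb ℓ 𝒜 n) (idealMaskPermProb ℓ 𝒜 n) (maskRealProb F κ ℓ 𝒜 n)
    linarith
  rw [h1, h5] at htri
  have hnonneg : 0 ≤ prpAdvantage F κ ℓ 𝒜 n + prpAdvantage F κ ℓ (𝒜.maskAdv B) n +
      4 * (((𝒜.fuel.eval n : ℕ) : ℝ) ^ 2 / 2 ^ n) := by
    have := prpAdvantage_nonneg F κ ℓ 𝒜 n
    have := prpAdvantage_nonneg F κ ℓ (𝒜.maskAdv B) n
    positivity
  rw [abs_of_nonneg hnonneg]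
  linarith

/-- **The `ε`-form consumed by the diagonalization of Thm. 7.6**: for every `δ > 0`, from some `n`
on the PRP game and the mask game of a PPT adversary differ by at most `δ`.
[cite: AaronsonChen2017, Thm. 7.6 (proof, p. 30)] -/
theorem maskedPRP_eventually_le {F : FunctionEnsemble} {κ ℓ : ℕ → ℕ} (hF : IsPRP F κ ℓ)
    (hℓ : ∀ n, n ≤ ℓ n) {𝒜 : OracleAdversary Bool} (h𝒜 : 𝒜.IsPPT encodingBoolBool) {δ : ℝ}
    (hδ : 0 < δ) :
    ∃ n₀ : ℕ, ∀ n, n₀ ≤ n → |prfRealProb F κ ℓ 𝒜 n - maskRealProb F κ ℓ 𝒜 n| ≤ δ := by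
  have h0 := (maskedPRP_indist hF hℓ h𝒜) 0
  simp only [pow_zero, one_mul] at h0
  have hev : ∀ᶠ n : ℕ in atTop, |prfRealProb F κ ℓ 𝒜 n - maskRealProb F κ ℓ 𝒜 n| < δ :=
    h0.eventually (gt_mem_nhds hδ)
  obtain ⟨n₀, hn₀⟩ := eventually_atTop.1 hev
  exact ⟨n₀, fun n hn => (hn₀ n hn).le⟩

end Literature.Computability.Cryptography

end
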